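import Mathlib.Algebra.MvPolynomial.Equiv
import Mathlib.Algebra.Polynomial.Roots
import Mathlib.Topology.Algebra.MvPolynomial
import Mathlib.MeasureTheory.Constructions.Pi
import Mathlib.MeasureTheory.Measure.Lebesgue.Basic
import Mathlib.MeasureTheory.Measure.Prod
import HarnessLib

/-!
# The zero set of a nonzero real polynomial is Lebesgue-null

For a nonzero polynomial `p ∈ ℝ[x₁, …, x_N]` the hypersurface `{x ∈ ℝᴺ | p(x) = 0}` has Lebesgue
measure zero (`MvPolynomial.volume_zeroSet_eq_zero`; general finite index type
`MvPolynomial.volume_zeroSet_eq_zero_of_fintype`; almost-everywhere form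
`MvPolynomial.ae_eval_ne_zero`; and for every measure absolutely continuous with respect to Lebesgue
measure, e.g. Gaussian product measures, `MvPolynomial.measure_zeroSet_eq_zero_of_ac`).

The proof is the textbook induction on the number of variables (R. Caron, T. Traynor, *The zero set
of a polynomial*, 2005; also e.g. Federer, *Geometric Measure Theory*, 2.6.5 / 3.1.24 area): write
`p` as a polynomial in the first variable with coefficients in the remaining ones
(`MvPolynomial.finSuccEquiv`); some coefficient `q_k` is a nonzero polynomial in `N` variables, so by
induction `q_k(s) ≠ 0` for almost every `s ∈ ℝᴺ`; for such `s` the section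
`{t | p(t, s) = 0}` is the root set of a nonzero univariate polynomial, hence finite, hence null; and
Tonelli (`Measure.prod_apply_symm`) along the measure-preserving split
`ℝ^{N+1} ≃ ℝ × ℝᴺ` (`volume_preserving_piFinSuccAbove`) gives measure zero.

Mathlib has the linear case (`MeasureTheory.Measure.addHaar_submodule`: proper subspaces are null)
but not the polynomial one (searched: `zeroLocus`, `roots` with `volume`, `MvPolynomial` with
`measure`). Used in the `quantum-advantage` family for almost-sure invertibility / full rank of
random matrices (`det` is a nonzero polynomial in the entries).

## References

* R. Caron, T. Traynor, *The zero set of a polynomial*, WSMR Report 05-02, Univ. of Windsor (2005)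
  (the statement and this proof).
* H. Federer, *Geometric Measure Theory*, Springer 1969, §2.6.5 (Fubini) — background.
-/

open MeasureTheory MvPolynomial

namespace MvPolynomial

/-- Over an empty set of variables a polynomial is the constant `coeff 0 p`, so its evaluation is that
constant. [folklore] -/
theorem eval_eq_coeff_zero_of_isEmpty {σ R : Type*} [CommSemiring R] [IsEmpty σ] (x : σ → R)
    (p : MvPolynomial σ R) : eval x p = p.coeff 0 := by
  conv_lhs => rw [MvPolynomial.eq_C_of_isEmpty p]
  rw [eval_C]

/-- A nonzero univariate real polynomial has a Lebesgue-null (indeed finite) zero set. [folklore] -/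
theorem _root_.Polynomial.volume_setOf_eval_eq_zero {P : Polynomial ℝ} (hP : P ≠ 0) :
    volume {t : ℝ | P.eval t = 0} = 0 := by
  classical
  have hfin : {t : ℝ | P.eval t = 0}.Finite := by
    refine (P.roots.toFinset.finite_toSet).subset fun t ht => ?_
    simp only [Set.mem_setOf_eq] at ht
    simp only [Finset.mem_coe, Multiset.mem_toFinset]
    exact (Polynomial.mem_roots hP).2 ht
  exact hfin.measure_zero volume

/-- **The zero set of a nonzero real polynomial in `N` variables is Lebesgue-null** (induction on `N`
through `finSuccEquiv` and Tonelli). [cite: CaronTraynor2005, Theorem (p. 1)] -/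
theorem volume_zeroSet_eq_zero : ∀ (N : ℕ) (p : MvPolynomial (Fin N) ℝ), p ≠ 0 →
    volume {x : Fin N → ℝ | eval x p = 0} = 0
  | 0, p, hp => by
    have hempty : {x : Fin 0 → ℝ | eval x p = 0} = ∅ := by
      ext x
      simp only [Set.mem_setOf_eq, Set.mem_empty_iff_false, iff_false]
      rw [eval_eq_coeff_zero_of_isEmpty]
      intro h
      apply hp
      rw [MvPolynomial.eq_C_of_isEmpty p, h, C_0]
    rw [hempty, measure_empty]
  | N + 1, p, hp => by
    classical
    -- `p` as a polynomial in the first variable with coefficients in the other `N`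
    set q : Polynomial (MvPolynomial (Fin N) ℝ) := finSuccEquiv ℝ N p with hq
    have hq0 : q ≠ 0 := by
      rw [hq]
      exact (EmbeddingLike.map_ne_zero_iff (f := finSuccEquiv ℝ N)).2 hp
    obtain ⟨k, hk⟩ : ∃ k, q.coeff k ≠ 0 := by
      by_contra h
      push Not at h
      exact hq0 (Polynomial.ext fun k => by rw [h k, Polynomial.coeff_zero])
    -- induction hypothesis for the coefficient `q_k`
    have IH : volume {s : Fin N → ℝ | eval s (q.coeff k) = 0} = 0 :=
      volume_zeroSet_eq_zero N (q.coeff k) hk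
    -- the zero set and its image in `ℝ × ℝ^N`
    set Z : Set (Fin (N + 1) → ℝ) := {x | eval x p = 0} with hZ
    have hZm : MeasurableSet Z :=
      (isClosed_eq (MvPolynomial.continuous_eval p) continuous_const).measurableSet
    set e := MeasurableEquiv.piFinSuccAbove (fun _ : Fin (N + 1) => ℝ) 0 with he
    have hmp : MeasurePreserving e volume volume :=
      volume_preserving_piFinSuccAbove (fun _ : Fin (N + 1) => ℝ) 0
    have hS : MeasurableSet (e.symm ⁻¹' Z) := hZm.preimage e.symm.measurable
    -- `vol Z = (vol × vol) (e.symm ⁻¹' Z)`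
    have h1 : volume Z = volume (e.symm ⁻¹' Z) := by
      rw [← hmp.measure_preimage hS.nullMeasurableSet]
      congr 1
      ext x
      simp
    rw [h1, Measure.volume_eq_prod, Measure.prod_apply_symm hS]
    -- the `s`-indexed sections are root sets of univariate polynomials
    have hsec : ∀ s : Fin N → ℝ, (fun t : ℝ => (t, s)) ⁻¹' (e.symm ⁻¹' Z) =
        {t : ℝ | (Polynomial.map (eval s) q).eval t = 0} := by
      intro s
      ext t
      simp only [Set.mem_preimage, Set.mem_setOf_eq, hZ, he,
        MeasurableEquiv.piFinSuccAbove_symm_apply]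
      change eval (Fin.insertNth 0 t s) p = 0 ↔ _
      rw [Fin.insertNth_zero', MvPolynomial.eval_eq_eval_mv_eval', ← hq]
    -- for almost every `s` the section polynomial is nonzero, hence has a null zero set
    have hae : (fun s : Fin N → ℝ => volume ((fun t : ℝ => (t, s)) ⁻¹' (e.symm ⁻¹' Z))) =ᵐ[volume]
        fun _ => 0 := by
      have hsub : {s : Fin N → ℝ | volume ((fun t : ℝ => (t, s)) ⁻¹' (e.symm ⁻¹' Z)) ≠ 0} ⊆
          {s | eval s (q.coeff k) = 0} := by
        intro s hs
        by_contra hne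
        apply hs
        rw [hsec s]
        apply Polynomial.volume_setOf_eval_eq_zero
        intro hzero
        apply hne
        have := congrArg (fun P : Polynomial ℝ => P.coeff k) hzero
        simpa [Polynomial.coeff_map] using this
      exact measure_mono_null hsub IH
    rw [lintegral_congr_ae hae, lintegral_zero]

/-- **The zero set of a nonzero real polynomial is Lebesgue-null**, for any finite set of variables.
[cite: CaronTraynor2005, Theorem (p. 1)] -/
theorem volume_zeroSet_eq_zero_of_fintype {σ : Type*} [Fintype σ] (p : MvPolynomial σ ℝ)
    (hp : p ≠ 0) : volume {x : σ → ℝ | eval x p = 0} = 0 := by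
  classical
  set N := Fintype.card σ
  set f : σ ≃ Fin N := Fintype.equivFin σ
  -- transport the polynomial to `Fin N` variables
  set p' : MvPolynomial (Fin N) ℝ := rename f p with hp'
  have hp'0 : p' ≠ 0 := by
    rw [hp']
    exact (MvPolynomial.rename_injective f f.injective).ne hp
  have h0 := volume_zeroSet_eq_zero N p' hp'0
  -- and the measure along `x ↦ x ∘ f.symm`
  have hmp : MeasurePreserving (MeasurableEquiv.piCongrLeft (fun _ : Fin N => ℝ) f) volume volume :=
    volume_measurePreserving_piCongrLeft (fun _ : Fin N => ℝ) f
  have hZm : MeasurableSet {x : Fin N → ℝ | eval x p' = 0} :=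
    (isClosed_eq (MvPolynomial.continuous_eval p') continuous_const).measurableSet
  have hpre : (MeasurableEquiv.piCongrLeft (fun _ : Fin N => ℝ) f) ⁻¹' {x : Fin N → ℝ | eval x p' = 0} =
      {x : σ → ℝ | eval x p = 0} := by
    ext x
    simp only [Set.mem_preimage, Set.mem_setOf_eq, hp', eval_rename]
    suffices h : (⇑(MeasurableEquiv.piCongrLeft (fun _ : Fin N => ℝ) f) x) ∘ f = x by rw [h]
    funext i
    simp [MeasurableEquiv.piCongrLeft, Equiv.piCongrLeft_apply_apply]
  rw [← hpre, hmp.measure_preimage hZm.nullMeasurableSet, h0]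

/-- Almost-everywhere form: a nonzero real polynomial is nonzero Lebesgue-almost everywhere.
[cite: CaronTraynor2005, Theorem (p. 1)] -/
theorem ae_eval_ne_zero {σ : Type*} [Fintype σ] (p : MvPolynomial σ ℝ) (hp : p ≠ 0) :
    ∀ᵐ x : σ → ℝ ∂volume, eval x p ≠ 0 := by
  rw [ae_iff]
  simpa using volume_zeroSet_eq_zero_of_fintype p hp

/-- For every measure absolutely continuous with respect to Lebesgue measure (e.g. a product of
Gaussian laws) the zero set of a nonzero real polynomial is null. [cite: CaronTraynor2005, Theorem (p. 1)] -/
theorem measure_zeroSet_eq_zero_of_ac {σ : Type*} [Fintype σ] {μ : Measure (σ → ℝ)}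
    (hμ : μ ≪ volume) (p : MvPolynomial σ ℝ) (hp : p ≠ 0) :
    μ {x : σ → ℝ | eval x p = 0} = 0 :=
  hμ (volume_zeroSet_eq_zero_of_fintype p hp)

end MvPolynomial
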